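import Literature.MathematicalPhysics.QuantumFieldTheory.Balaban1983to89.T4Cov2156Rate

/-!
# Route «BalabanUVNodes», cluster K4 «SpineRates» — node N15 = NE2, UNIT-LATTICE LAYER WITH THE BACKGROUND LIVE, file U-B (dag-n15-a g16, LOCATED-1):
# THE DRESSING OF THE (1.66) MATRIX — `P = −Sym[(a·1 + Δ_k)·Z·(a·1 + Δ_k)]`, the linearisation at `U ≡ 1` of Bałaban's `(QG(U)Q*)⁻¹ − a` through the printed
# `(QGQ*)⁻¹ = a·I + Δ_k` ([B5] (1.101)–(1.103) p.34) — its symmetry, entry letters and η-difference letters from those of the middle factor `Z`, GENERIC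

Cell `pub-ymgap`, seat `pub-ymgap-dag-n15-a` (-a KNIT-BY-NAME seat of node N15; HUMAN RULING D-0062; chair R424 venue), generation 16, file U-B of the LOCATED-1
programme (INBOX l.22312 ∕ l.22757).  `bears_on: R4∕N15 · K3⁷ SpineGivenEndpointR13SepCoPH (stmt-QuantumFields-20544)`.  Filed `--kind proof --supports stmt-QuantumFields-20544
--as helper` — COUNT-NEUTRAL.  Two data `def`s (`symPart`, `dressP`), the rest theorems; 0 `sorry`.  Imports BY NAME pub-balaban's `T4Cov2156Rate` (through it: THE matrix
`deltaPol M n` of the (1.66) form, `kernelDecay166`, `kernelRate166`, King's generic `triple_decay_bound`, `bondSum_le`, `bondDist_nonneg∕_triangle`); nothing in the tree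
is modified.

WHY.  File U-A proved positivity, uniform decay and King's (4.38)-shaped η-rate of the perturbed covariance `C(C*(Δ_k + P)C)⁻¹C*` for ANY symmetric, exponentially decaying,
small `P` with an η-difference letter.  The model's `P` (files U-C∕U-D) is the FIRST-ORDER dressing of the (1.66) form by the background: Bałaban's unit-lattice action in a
background is `Δ_k(U) = (Q_kG_k(U)Q_k*)⁻¹ − a` ([B5] (1.65)–(1.66) p.29 with (1.101)–(1.103) p.34: `(Q_kG_kQ_k*)⁻¹ = a·I + Δ_k` at `U ≡ 1`, tree `B5QGQ199Rate` per fibre —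
cited as MOTIVATION; the position-space identity is NOT used here), so to first order in `G_k(U) − G_k`:
`Δ_k(U) − Δ_k ≈ −(a·1 + Δ_k)·Q_k(G_k(U) − G_k)Q_k*·(a·1 + Δ_k)`; the model symmetrises (a quadratic form).  THIS FILE is the matrix algebra of that dressing, blind to
where the middle factor `Z = Q_k(G_k(U) − G_k)Q_k*` comes from:
* §1 `bondDist_comm`, `bondDist_self`; the symmetric part `symPart X = ½(X + Xᵀ)`: `symPart_isSymm`, `symPart_sub`, `symPart_zero`, `abs_symPart_le` (a symmetric entry
  majorant passes to the symmetric part);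
* §2 def `dressP a Δ Z := −symPart ((a·1 + Δ)·Z·(a·1 + Δ))`: `dressP_isSymm`, `dressP_zero`, `abs_smul_one_add_le` (`|(a·1 + Δ)(b,b′)| ≤ (|a| + c₀)e^{−δρ}`), ★ `abs_dressP_le`
  (`|Z| ≤ ζe^{−κρ}`, `|Δ| ≤ c₀e^{−κρ}` ⟹ `|dressP| ≤ (|a|+c₀)²·ζ·V²·e^{−(κ∕2)ρ}`, `triple_decay_bound`), `dressP_sub` (the three-term Leibniz identity, `A′ − A = Δ′ − Δ`),
  ★ `abs_dressP_sub_le` (from `|Δ′ − Δ| ≤ θe^{−κρ}`, `|Z′ − Z| ≤ τe^{−κρ}` and the majorants: `≤ (|a|+c₀+θ)²·(2θζ + τ)·V²·e^{−(κ∕2)ρ}`);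
* §3 ★★ `dressP_deltaPol_letters`: the (1.66) INSTANCE with UNIFORM constants — for `d ≥ 1` and a middle-factor rate `δ_Z > 0` there are `K, δ′ > 0` (after `d, δ_Z`) such that for
  every torus, all levels `n₁ ≥ 1`, `n₂ = Rn₁`, every `a` and all `Z, Z′` with `|Z|, |Z′| ≤ ζe^{−δ_Zρ}`, `|Z′ − Z| ≤ τe^{−δ_Zρ}`:
  `|dressP a Δ^{(n₁)} Z| ≤ K(|a|+1)²ζ·e^{−δ′ρ}`, `|dressP a Δ^{(n₂)} Z′| ≤ K(|a|+1)²ζ·e^{−δ′ρ}` and `|dressP a Δ^{(n₂)} Z′ − dressP a Δ^{(n₁)} Z| ≤ K(|a|+1)²(τ + ζ·n₁⁻¹)·e^{−δ′ρ}`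
  (`kernelDecay166`, `kernelRate166`) — exactly the three letters U-A's `cov2156_rate_torus_add` consumes, with `ε = K(|a|+1)²ζ` and `τ′ = K(|a|+1)²(τ + ζn₁⁻¹)`.

HONEST FRAMING.  Finite-dimensional matrix algebra, count-neutral; MODEL-LEVEL in exactly one respect: the dressing is the LINEARISATION (first order in the background,
consistent with the first-order species `V′₁` that produces `G_k(U)` in files U-C∕U-D) and is SYMMETRISED; the printed identity (1.103) motivating it is NOT re-certified in
position space.  GENUINE: THE (1.66) matrix and its pub-balaban letters.  NOT [B9] Thm 3.15 at a general `U` (NOT PRINTED as an η-rate; G-B9-09∕10).  N15 NOT discharged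
(typed 28∕28 · discharged 5∕27 of record unchanged); nothing continuum ∕ ℝ⁴ ∕ OS ∕ mass-gap ∕ Clay.  Restate-immune (no Theses import).
-/

set_option autoImplicit false

noncomputable section

open Finset Matrix

namespace Summit.QuantumFields.YangMills.BalabanUVNodes.N15.UnitLayerBg

open Literature.MathematicalPhysics.QuantumFieldTheory.Balaban1983to89
open Literature.MathematicalPhysics.QuantumFieldTheory.King1986 (triple_decay_bound exp_decay_mono)
open Literature.MathematicalPhysics.QuantumFieldTheory.Balaban1983to89.B6Lemma24Torus (pbox)
open Literature.MathematicalPhysics.QuantumFieldTheory.Balaban1983to89.B6BondEliminationTorus (pdist)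
open Literature.MathematicalPhysics.QuantumFieldTheory.Balaban1983to89.B6Cov2156Torus (deltaPol one_le_M)
open Literature.MathematicalPhysics.QuantumFieldTheory.Balaban1983to89.B5Kernel166Decay (kernelDecay166)
open Literature.MathematicalPhysics.QuantumFieldTheory.Balaban1983to89.T4Cov2156Rate (kernelRate166 bondDist_nonneg bondDist_triangle bondSum_le)
open Literature.MathematicalPhysics.QuantumFieldTheory.Balaban1983to89.B4Sect5Proof (latticeConst latticeConst_nonneg)
open Literature.MathematicalPhysics.QuantumFieldTheory.Balaban1983to89.B4Sect5Torus (tdist_symm tdist_self)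

variable {d : ℕ}

/-! ## §1 The bond distance is a pseudo-metric; the symmetric part -/

section Dist

variable {M : Fin d → ℕ}

/-- `ρ_M(b₋, b′₋) = ρ_M(b′₋, b₋)`. [folklore] -/
theorem bondDist_comm (hM1 : ∀ i, 1 ≤ M i) (p q : B4.Idx (pbox M) d) :
    pdist M hM1 (p.1 : Fin d → ℤ) (q.1 : Fin d → ℤ) = pdist M hM1 (q.1 : Fin d → ℤ) (p.1 : Fin d → ℤ) := by
  unfold pdist
  exact tdist_symm hM1 _ _

/-- `ρ_M(b₋, b₋) = 0`. [folklore] -/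
theorem bondDist_self (hM1 : ∀ i, 1 ≤ M i) (p : B4.Idx (pbox M) d) : pdist M hM1 (p.1 : Fin d → ℤ) (p.1 : Fin d → ℤ) = 0 := by
  unfold pdist
  exact tdist_self _ _

end Dist

section Sym

variable {ι : Type} [Fintype ι] [DecidableEq ι]

/-- THE SYMMETRIC PART `½(X + Xᵀ)` of a square matrix (a quadratic form sees only it). [folklore] -/
def symPart (X : Matrix ι ι ℝ) : Matrix ι ι ℝ := (2 : ℝ)⁻¹ • (X + Xᵀ)

omit [Fintype ι] [DecidableEq ι] in
/-- entries of the symmetric part. [folklore] -/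
theorem symPart_apply (X : Matrix ι ι ℝ) (p q : ι) : symPart X p q = (2 : ℝ)⁻¹ * (X p q + X q p) := by
  simp [symPart, Matrix.add_apply, Matrix.transpose_apply]

omit [Fintype ι] [DecidableEq ι] in
/-- the symmetric part is symmetric. [folklore] -/
theorem symPart_isSymm (X : Matrix ι ι ℝ) : (symPart X).IsSymm := by
  refine Matrix.IsSymm.ext fun p q => ?_
  rw [symPart_apply, symPart_apply, add_comm]

omit [Fintype ι] [DecidableEq ι] in
/-- linearity: `Sym X − Sym Y = Sym (X − Y)`. [folklore] -/
theorem symPart_sub (X Y : Matrix ι ι ℝ) : symPart X - symPart Y = symPart (X - Y) := by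
  ext p q
  simp only [Matrix.sub_apply, symPart_apply]
  ring

omit [Fintype ι] [DecidableEq ι] in
/-- `Sym 0 = 0`. [folklore] -/
theorem symPart_zero : symPart (0 : Matrix ι ι ℝ) = 0 := by
  ext p q
  simp [symPart_apply]

omit [Fintype ι] [DecidableEq ι] in
/-- `Sym (−X) = −Sym X`. [folklore] -/
theorem symPart_neg (X : Matrix ι ι ℝ) : symPart (-X) = -symPart X := by
  ext p q
  simp only [symPart_apply, Matrix.neg_apply]
  ring

omit [Fintype ι] [DecidableEq ι] in
/-- A SYMMETRIC entry majorant passes to the symmetric part: `|X(p,q)| ≤ f(p,q)`, `f(p,q) = f(q,p)` ⟹ `|Sym X(p,q)| ≤ f(p,q)`. [folklore] -/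
theorem abs_symPart_le {X : Matrix ι ι ℝ} {f : ι → ι → ℝ} (hX : ∀ p q, |X p q| ≤ f p q) (hf : ∀ p q, f p q = f q p) (p q : ι) :
    |symPart X p q| ≤ f p q := by
  rw [symPart_apply, abs_mul, abs_of_pos (by norm_num : (0 : ℝ) < 2⁻¹)]
  have h1 := hX p q
  have h2 := hX q p
  rw [← hf p q] at h2
  have h3 : |X p q + X q p| ≤ f p q + f p q := (abs_add_le _ _).trans (add_le_add h1 h2)
  nlinarith [abs_nonneg (X p q + X q p)]

end Sym

/-! ## §2 The dressing `−Sym[(a·1 + Δ) Z (a·1 + Δ)]`: symmetry, entry letters, the three-term Leibniz identity and the η-difference letters -/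

section Dress

variable {ι : Type} [Fintype ι] [DecidableEq ι]

/-- THE FIRST-ORDER DRESSING OF A UNIT-LATTICE FORM `Δ` BY A MIDDLE FACTOR `Z`: `−Sym[(a·1 + Δ)·Z·(a·1 + Δ)]` — the linearisation at `U ≡ 1` of `(Q_kG_k(U)Q_k*)⁻¹ − a`
through the printed `(Q_kG_kQ_k*)⁻¹ = a·I + Δ_k`, symmetrised. [cite: Balaban1984PropagatorsI, (1.101)–(1.103) p.34 (motivating identity); (1.65)–(1.66) p.29 (object)] -/
def dressP (a : ℝ) (Δ Z : Matrix ι ι ℝ) : Matrix ι ι ℝ := -symPart ((a • (1 : Matrix ι ι ℝ) + Δ) * Z * (a • (1 : Matrix ι ι ℝ) + Δ))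

omit [Fintype ι] [DecidableEq ι] in
/-- the negative of a symmetric matrix is symmetric. [folklore] -/
theorem isSymm_neg {X : Matrix ι ι ℝ} (h : X.IsSymm) : (-X).IsSymm := by
  unfold Matrix.IsSymm at h ⊢
  rw [Matrix.transpose_neg, h]

/-- the dressing is symmetric. [folklore] -/
theorem dressP_isSymm (a : ℝ) (Δ Z : Matrix ι ι ℝ) : (dressP a Δ Z).IsSymm := isSymm_neg (symPart_isSymm _)

/-- no middle factor, no dressing: `dressP a Δ 0 = 0` (at `U ≡ 1` the perturbed form IS the (1.66) matrix). [folklore] -/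
theorem dressP_zero (a : ℝ) (Δ : Matrix ι ι ℝ) : dressP a Δ 0 = 0 := by
  simp [dressP, symPart_zero]

/-- **THE THREE-TERM LEIBNIZ IDENTITY**: with `A = a·1 + Δ`, `A′ = a·1 + Δ′` (so `A′ − A = Δ′ − Δ`),
`dressP a Δ′ Z′ − dressP a Δ Z = −Sym[(Δ′ − Δ)Z′A′ + A(Z′ − Z)A′ + AZ(Δ′ − Δ)]`. [folklore] -/
theorem dressP_sub (a : ℝ) (Δ Δ' Z Z' : Matrix ι ι ℝ) :
    dressP a Δ' Z' - dressP a Δ Z =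
      -symPart ((Δ' - Δ) * Z' * (a • (1 : Matrix ι ι ℝ) + Δ') + (a • (1 : Matrix ι ι ℝ) + Δ) * (Z' - Z) * (a • (1 : Matrix ι ι ℝ) + Δ')
        + (a • (1 : Matrix ι ι ℝ) + Δ) * Z * (Δ' - Δ)) := by
  unfold dressP
  rw [neg_sub_neg, symPart_sub, ← symPart_neg]
  congr 1
  have hA : (a • (1 : Matrix ι ι ℝ) + Δ') - (a • (1 : Matrix ι ι ℝ) + Δ) = Δ' - Δ := add_sub_add_left_eq_sub _ _ _
  have key : ∀ A A' : Matrix ι ι ℝ, A * Z * A - A' * Z' * A' = -((A' - A) * Z' * A' + A * (Z' - Z) * A' + A * Z * (A' - A)) :=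
    fun A A' => by noncomm_ring
  rw [key (a • (1 : Matrix ι ι ℝ) + Δ) (a • (1 : Matrix ι ι ℝ) + Δ'), hA]

variable (ρ : ι → ι → ℝ)

omit [Fintype ι] in
/-- `|(a·1 + Δ)(p,q)| ≤ (|a| + c₀)·e^{−δρ(p,q)}` from `|Δ(p,q)| ≤ c₀e^{−δρ(p,q)}` (`ρ(p,p) = 0`). [folklore] -/
theorem abs_smul_one_add_le (hρ0 : ∀ p, ρ p p = 0) {Δ : Matrix ι ι ℝ} {a c₀ δ : ℝ}
    (hΔ : ∀ p q, |Δ p q| ≤ c₀ * Real.exp (-(δ * ρ p q))) (p q : ι) :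
    |(a • (1 : Matrix ι ι ℝ) + Δ) p q| ≤ (|a| + c₀) * Real.exp (-(δ * ρ p q)) := by
  rw [Matrix.add_apply, Matrix.smul_apply, smul_eq_mul]
  have hE := Real.exp_nonneg (-(δ * ρ p q))
  by_cases h : p = q
  · subst h
    rw [Matrix.one_apply_eq, mul_one, hρ0, mul_zero, neg_zero, Real.exp_zero, mul_one]
    have := hΔ p p
    rw [hρ0, mul_zero, neg_zero, Real.exp_zero, mul_one] at this
    exact (abs_add_le _ _).trans (add_le_add le_rfl this)
  · rw [Matrix.one_apply_ne h, mul_zero, zero_add]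
    exact (hΔ p q).trans (by nlinarith [abs_nonneg a])

/-- ★ **THE ENTRY LETTER OF THE DRESSING**: `|Δ| ≤ c₀e^{−κρ}`, `|Z| ≤ ζe^{−κρ}`, half-rate sums `≤ V` ⟹ `|dressP a Δ Z (p,q)| ≤ (|a|+c₀)·ζ·(|a|+c₀)·V²·e^{−(κ∕2)ρ(p,q)}`
(`triple_decay_bound`; the symmetric part by `abs_symPart_le`, `ρ` symmetric). [folklore] -/
theorem abs_dressP_le (hρ0 : ∀ p, ρ p p = 0) (hρ : ∀ p q, 0 ≤ ρ p q) (hρs : ∀ p q, ρ p q = ρ q p) (hρt : ∀ p q r, ρ p r ≤ ρ p q + ρ q r)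
    {Δ Z : Matrix ι ι ℝ} {a c₀ ζ κ V : ℝ} (hc₀ : 0 ≤ c₀) (hζ : 0 ≤ ζ) (hκ : 0 ≤ κ)
    (hΔ : ∀ p q, |Δ p q| ≤ c₀ * Real.exp (-(κ * ρ p q))) (hZ : ∀ p q, |Z p q| ≤ ζ * Real.exp (-(κ * ρ p q)))
    (hV : ∀ p, ∑ q, Real.exp (-(κ / 2 * ρ p q)) ≤ V) (p q : ι) :
    |dressP a Δ Z p q| ≤ (|a| + c₀) * ζ * (|a| + c₀) * V ^ 2 * Real.exp (-(κ / 2 * ρ p q)) := by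
  unfold dressP
  rw [Matrix.neg_apply, abs_neg]
  have hA := abs_smul_one_add_le ρ hρ0 (a := a) hΔ
  have htri := triple_decay_bound ρ hρ hρt (a • (1 : Matrix ι ι ℝ) + Δ) Z (a • (1 : Matrix ι ι ℝ) + Δ) hκ (by positivity) hζ hA hZ hA hV
  exact abs_symPart_le htri (fun p q => by rw [hρs p q]) p q

/-- ★ **THE η-DIFFERENCE LETTER OF THE DRESSING**: `|Δ|, |Δ′| ≤ c₀e^{−κρ}`, `|Δ′ − Δ| ≤ θe^{−κρ}`, `|Z|, |Z′| ≤ ζe^{−κρ}`, `|Z′ − Z| ≤ τe^{−κρ}`, half-rate sums `≤ V` ⟹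
`|dressP a Δ′ Z′ (p,q) − dressP a Δ Z (p,q)| ≤ (|a|+c₀)²·(2θζ + τ)... ` precisely `≤ (θ·ζ·(|a|+c₀) + (|a|+c₀)·τ·(|a|+c₀) + (|a|+c₀)·ζ·θ)·V²·e^{−(κ∕2)ρ(p,q)}`
(`dressP_sub` + `triple_decay_bound` ×3). [folklore] -/
theorem abs_dressP_sub_le (hρ0 : ∀ p, ρ p p = 0) (hρ : ∀ p q, 0 ≤ ρ p q) (hρs : ∀ p q, ρ p q = ρ q p) (hρt : ∀ p q r, ρ p r ≤ ρ p q + ρ q r)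
    {Δ Δ' Z Z' : Matrix ι ι ℝ} {a c₀ θ ζ τ κ V : ℝ} (hc₀ : 0 ≤ c₀) (hθ : 0 ≤ θ) (hζ : 0 ≤ ζ) (hτ : 0 ≤ τ) (hκ : 0 ≤ κ)
    (hΔ : ∀ p q, |Δ p q| ≤ c₀ * Real.exp (-(κ * ρ p q))) (hΔ' : ∀ p q, |Δ' p q| ≤ c₀ * Real.exp (-(κ * ρ p q)))
    (hΔΔ : ∀ p q, |(Δ' - Δ) p q| ≤ θ * Real.exp (-(κ * ρ p q)))
    (hZ : ∀ p q, |Z p q| ≤ ζ * Real.exp (-(κ * ρ p q))) (hZ' : ∀ p q, |Z' p q| ≤ ζ * Real.exp (-(κ * ρ p q)))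
    (hZZ : ∀ p q, |(Z' - Z) p q| ≤ τ * Real.exp (-(κ * ρ p q)))
    (hV : ∀ p, ∑ q, Real.exp (-(κ / 2 * ρ p q)) ≤ V) (p q : ι) :
    |dressP a Δ' Z' p q - dressP a Δ Z p q| ≤
      (θ * ζ * (|a| + c₀) + (|a| + c₀) * τ * (|a| + c₀) + (|a| + c₀) * ζ * θ) * V ^ 2 * Real.exp (-(κ / 2 * ρ p q)) := by
  have e := congrArg (fun N : Matrix ι ι ℝ => N p q) (dressP_sub a Δ Δ' Z Z')
  simp only [Matrix.sub_apply] at e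
  rw [e, Matrix.neg_apply, abs_neg]
  have hA := abs_smul_one_add_le ρ hρ0 (a := a) hΔ
  have hA' := abs_smul_one_add_le ρ hρ0 (a := a) hΔ'
  have hac : 0 ≤ |a| + c₀ := by positivity
  have t1 := triple_decay_bound ρ hρ hρt (Δ' - Δ) Z' (a • (1 : Matrix ι ι ℝ) + Δ') hκ hθ hζ hΔΔ hZ' hA' hV
  have t2 := triple_decay_bound ρ hρ hρt (a • (1 : Matrix ι ι ℝ) + Δ) (Z' - Z) (a • (1 : Matrix ι ι ℝ) + Δ') hκ hac hτ hA hZZ hA' hV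
  have t3 := triple_decay_bound ρ hρ hρt (a • (1 : Matrix ι ι ℝ) + Δ) Z (Δ' - Δ) hκ hac hζ hA hZ hΔΔ hV
  have hsum : ∀ p q, |((Δ' - Δ) * Z' * (a • (1 : Matrix ι ι ℝ) + Δ') + (a • (1 : Matrix ι ι ℝ) + Δ) * (Z' - Z) * (a • (1 : Matrix ι ι ℝ) + Δ')
      + (a • (1 : Matrix ι ι ℝ) + Δ) * Z * (Δ' - Δ)) p q| ≤
      (θ * ζ * (|a| + c₀) + (|a| + c₀) * τ * (|a| + c₀) + (|a| + c₀) * ζ * θ) * V ^ 2 * Real.exp (-(κ / 2 * ρ p q)) := by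
    intro p q
    rw [Matrix.add_apply, Matrix.add_apply]
    refine (abs_add_le _ _).trans ((add_le_add (abs_add_le _ _) le_rfl).trans ?_)
    have := add_le_add (add_le_add (t1 p q) (t2 p q)) (t3 p q)
    refine this.trans (le_of_eq ?_)
    ring
  exact abs_symPart_le hsum (fun p q => by rw [hρs p q]) p q

end Dress

/-! ## §3 The (1.66) instance: uniform constants on every unit torus -/

section DeltaPol

variable (d) in
/-- ★★ **THE DRESSING LETTERS OF THE (1.66) MATRIX, UNIFORM.**  Let `d ≥ 1` and a middle-factor rate `δ_Z > 0`.  There are `K, δ′ > 0` (depending on `d, δ_Z` only) such that for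
EVERY unit torus `M`, ALL levels `n₁ ≥ 1`, `n₂ = R·n₁` (`R ≥ 1`), EVERY coupling `a` and ALL middle factors `Z, Z′` with `|Z(b,b′)|, |Z′(b,b′)| ≤ ζ·e^{−δ_Zρ_M(b₋,b′₋)}`
(`ζ ≥ 0`) and `|Z′(b,b′) − Z(b,b′)| ≤ τ·e^{−δ_Zρ_M(b₋,b′₋)}` (`τ ≥ 0`):
(i) `|dressP a Δ^{(n₁)} Z (b,b′)| ≤ K(|a|+1)²ζ·e^{−δ′ρ}`, (ii) `|dressP a Δ^{(n₂)} Z′ (b,b′)| ≤ K(|a|+1)²ζ·e^{−δ′ρ}`,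
(iii) `|dressP a Δ^{(n₂)} Z′ (b,b′) − dressP a Δ^{(n₁)} Z (b,b′)| ≤ K(|a|+1)²(τ + ζ·n₁⁻¹)·e^{−δ′ρ}` — `Δ^{(n)} = deltaPol M n`; inputs `kernelDecay166` (`|Δ^{(n)}| ≤ c₀e^{−δ₀ρ}`),
`kernelRate166` (`|Δ^{(n₂)} − Δ^{(n₁)}| ≤ θ₀n₁⁻¹e^{−δ₁ρ}`), King's sums `bondSum_le`, §2. [cite: Balaban1984PropagatorsI, (1.66) p.29 (object); King1986, (4.40)–(4.41) pp.674–675 (mechanism)] [folklore] -/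
theorem dressP_deltaPol_letters (hd : 1 ≤ d) {δZ : ℝ} (hδZ : 0 < δZ) :
    ∃ K δ' : ℝ, 0 < K ∧ 0 < δ' ∧
      ∀ (M : Fin d → ℕ) [∀ μ, NeZero (M μ)] (n₁ n₂ R : ℕ), 1 ≤ n₁ → 1 ≤ R → n₂ = R * n₁ →
        ∀ (a : ℝ) (Z Z' : Matrix (B4.Idx (pbox M) d) (B4.Idx (pbox M) d) ℝ) (ζ τ : ℝ), 0 ≤ ζ → 0 ≤ τ →
        (∀ p q : B4.Idx (pbox M) d, |Z p q| ≤ ζ * Real.exp (-(δZ * pdist M (one_le_M M) (p.1 : Fin d → ℤ) (q.1 : Fin d → ℤ)))) →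
        (∀ p q : B4.Idx (pbox M) d, |Z' p q| ≤ ζ * Real.exp (-(δZ * pdist M (one_le_M M) (p.1 : Fin d → ℤ) (q.1 : Fin d → ℤ)))) →
        (∀ p q : B4.Idx (pbox M) d, |Z' p q - Z p q| ≤ τ * Real.exp (-(δZ * pdist M (one_le_M M) (p.1 : Fin d → ℤ) (q.1 : Fin d → ℤ)))) →
        (∀ p q : B4.Idx (pbox M) d, |dressP a (deltaPol M n₁) Z p q|
            ≤ K * (|a| + 1) ^ 2 * ζ * Real.exp (-(δ' * pdist M (one_le_M M) (p.1 : Fin d → ℤ) (q.1 : Fin d → ℤ)))) ∧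
        (∀ p q : B4.Idx (pbox M) d, |dressP a (deltaPol M n₂) Z' p q|
            ≤ K * (|a| + 1) ^ 2 * ζ * Real.exp (-(δ' * pdist M (one_le_M M) (p.1 : Fin d → ℤ) (q.1 : Fin d → ℤ)))) ∧
        (∀ p q : B4.Idx (pbox M) d, |dressP a (deltaPol M n₂) Z' p q - dressP a (deltaPol M n₁) Z p q|
            ≤ K * (|a| + 1) ^ 2 * (τ + ζ * (n₁ : ℝ)⁻¹) * Real.exp (-(δ' * pdist M (one_le_M M) (p.1 : Fin d → ℤ) (q.1 : Fin d → ℤ)))) := by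
  obtain ⟨c₀, δ₀, hc₀, hδ₀, hK⟩ := kernelDecay166 (d := d) hd
  obtain ⟨θ₀, δ₁, hθ₀, hδ₁, hR⟩ := kernelRate166 (d := d) hd
  set κ := min (min δ₀ δ₁) δZ with hκdef
  have hκ : 0 < κ := lt_min (lt_min hδ₀ hδ₁) hδZ
  have hκδ₀ : κ ≤ δ₀ := (min_le_left _ _).trans (min_le_left _ _)
  have hκδ₁ : κ ≤ δ₁ := (min_le_left _ _).trans (min_le_right _ _)
  have hκZ : κ ≤ δZ := min_le_right _ _
  set V := (d : ℝ) * latticeConst d (κ / 2) with hV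
  have hV0 : 0 ≤ V := mul_nonneg (Nat.cast_nonneg _) (latticeConst_nonneg d (half_pos hκ).le)
  -- K majorises (c₀+1)²·V² and (c₀+1)²(2θ₀+1)·V²
  refine ⟨(c₀ + 1) ^ 2 * (2 * θ₀ + 1) * V ^ 2 + 1, κ / 2, by positivity, half_pos hκ, ?_⟩
  intro M _ n₁ n₂ R' hn₁ hR1 h a Z Z' ζ τ hζ hτ hZ hZ' hZZ
  set ρ : B4.Idx (pbox M) d → B4.Idx (pbox M) d → ℝ := fun p q => pdist M (one_le_M M) (p.1 : Fin d → ℤ) (q.1 : Fin d → ℤ) with hρdef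
  have hρ0 : ∀ p, ρ p p = 0 := fun p => bondDist_self (one_le_M M) p
  have hρn : ∀ p q, 0 ≤ ρ p q := bondDist_nonneg (one_le_M M)
  have hρs : ∀ p q, ρ p q = ρ q p := fun p q => bondDist_comm (one_le_M M) p q
  have hρt : ∀ p q r, ρ p r ≤ ρ p q + ρ q r := bondDist_triangle (one_le_M M)
  have hn₂ : 1 ≤ n₂ := by subst h; exact Nat.one_le_iff_ne_zero.mpr (Nat.mul_ne_zero (by omega) (by omega))
  have hΔ₁ : ∀ p q, |deltaPol M n₁ p q| ≤ c₀ * Real.exp (-(κ * ρ p q)) := fun p q => (hK M n₁ hn₁ p q).trans (exp_decay_mono hc₀.le hκδ₀ (hρn p q))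
  have hΔ₂ : ∀ p q, |deltaPol M n₂ p q| ≤ c₀ * Real.exp (-(κ * ρ p q)) := fun p q => (hK M n₂ hn₂ p q).trans (exp_decay_mono hc₀.le hκδ₀ (hρn p q))
  have hθn : 0 ≤ θ₀ * (n₁ : ℝ)⁻¹ := mul_nonneg hθ₀.le (inv_nonneg.mpr (Nat.cast_nonneg _))
  have hΔΔ : ∀ p q, |(deltaPol M n₂ - deltaPol M n₁) p q| ≤ θ₀ * (n₁ : ℝ)⁻¹ * Real.exp (-(κ * ρ p q)) := fun p q => by
    rw [Matrix.sub_apply]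
    exact (hR M n₁ n₂ R' hn₁ hR1 h p q).trans (exp_decay_mono hθn hκδ₁ (hρn p q))
  have hZκ : ∀ p q, |Z p q| ≤ ζ * Real.exp (-(κ * ρ p q)) := fun p q => (hZ p q).trans (exp_decay_mono hζ hκZ (hρn p q))
  have hZ'κ : ∀ p q, |Z' p q| ≤ ζ * Real.exp (-(κ * ρ p q)) := fun p q => (hZ' p q).trans (exp_decay_mono hζ hκZ (hρn p q))
  have hZZκ : ∀ p q, |(Z' - Z) p q| ≤ τ * Real.exp (-(κ * ρ p q)) := fun p q => by
    rw [Matrix.sub_apply]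
    exact (hZZ p q).trans (exp_decay_mono hτ hκZ (hρn p q))
  have hVb : ∀ p, ∑ q, Real.exp (-(κ / 2 * ρ p q)) ≤ V := fun p => bondSum_le (one_le_M M) (half_pos hκ) p
  have hac : |a| + c₀ ≤ (c₀ + 1) * (|a| + 1) := by nlinarith [abs_nonneg a]
  have hac0 : 0 ≤ |a| + c₀ := by positivity
  have hn0 : 0 ≤ (n₁ : ℝ)⁻¹ := inv_nonneg.mpr (Nat.cast_nonneg _)
  -- bookkeeping abbreviations (as plain facts, no `set`)
  have hS1 : (1 : ℝ) ≤ (|a| + 1) ^ 2 := one_le_pow₀ (by linarith [abs_nonneg a])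
  have hS0 : (0 : ℝ) ≤ (|a| + 1) ^ 2 := by positivity
  have hc1 : (1 : ℝ) ≤ (c₀ + 1) * (|a| + 1) := by nlinarith [abs_nonneg a]
  have hA1 : |a| + c₀ ≤ (c₀ + 1) ^ 2 * (|a| + 1) ^ 2 := by
    calc |a| + c₀ ≤ (c₀ + 1) * (|a| + 1) := hac
      _ = (c₀ + 1) * (|a| + 1) * 1 := (mul_one _).symm
      _ ≤ (c₀ + 1) * (|a| + 1) * ((c₀ + 1) * (|a| + 1)) := mul_le_mul_of_nonneg_left hc1 (by positivity)
      _ = (c₀ + 1) ^ 2 * (|a| + 1) ^ 2 := by ring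
  have hA2 : (|a| + c₀) ^ 2 ≤ (c₀ + 1) ^ 2 * (|a| + 1) ^ 2 := by
    rw [← mul_pow]; exact pow_le_pow_left₀ hac0 hac 2
  have hV2 : (0 : ℝ) ≤ V ^ 2 := sq_nonneg _
  have hcV : (c₀ + 1) ^ 2 * V ^ 2 ≤ (c₀ + 1) ^ 2 * (2 * θ₀ + 1) * V ^ 2 + 1 := by
    have h1 : (c₀ + 1) ^ 2 * V ^ 2 ≤ (c₀ + 1) ^ 2 * V ^ 2 * (2 * θ₀ + 1) := le_mul_of_one_le_right (by positivity) (by linarith)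
    linarith
  have hθV : 2 * θ₀ * ((c₀ + 1) ^ 2 * V ^ 2) ≤ (c₀ + 1) ^ 2 * (2 * θ₀ + 1) * V ^ 2 + 1 := by
    have h1 : 2 * θ₀ * ((c₀ + 1) ^ 2 * V ^ 2) ≤ (2 * θ₀ + 1) * ((c₀ + 1) ^ 2 * V ^ 2) := mul_le_mul_of_nonneg_right (by linarith) (by positivity)
    linarith
  -- the entry amplitude: A ζ A V² ≤ K (|a|+1)² ζ
  have hamp : (|a| + c₀) * ζ * (|a| + c₀) * V ^ 2 ≤ ((c₀ + 1) ^ 2 * (2 * θ₀ + 1) * V ^ 2 + 1) * (|a| + 1) ^ 2 * ζ := by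
    calc (|a| + c₀) * ζ * (|a| + c₀) * V ^ 2 = (|a| + c₀) ^ 2 * V ^ 2 * ζ := by ring
      _ ≤ (c₀ + 1) ^ 2 * (|a| + 1) ^ 2 * V ^ 2 * ζ := mul_le_mul_of_nonneg_right (mul_le_mul_of_nonneg_right hA2 hV2) hζ
      _ = (c₀ + 1) ^ 2 * V ^ 2 * (|a| + 1) ^ 2 * ζ := by ring
      _ ≤ ((c₀ + 1) ^ 2 * (2 * θ₀ + 1) * V ^ 2 + 1) * (|a| + 1) ^ 2 * ζ := mul_le_mul_of_nonneg_right (mul_le_mul_of_nonneg_right hcV hS0) hζ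
  refine ⟨fun p q => ?_, fun p q => ?_, fun p q => ?_⟩
  · exact (abs_dressP_le ρ hρ0 hρn hρs hρt hc₀.le hζ hκ.le hΔ₁ hZκ hVb p q).trans (mul_le_mul_of_nonneg_right hamp (Real.exp_nonneg _))
  · exact (abs_dressP_le ρ hρ0 hρn hρs hρt hc₀.le hζ hκ.le hΔ₂ hZ'κ hVb p q).trans (mul_le_mul_of_nonneg_right hamp (Real.exp_nonneg _))
  · refine (abs_dressP_sub_le ρ hρ0 hρn hρs hρt hc₀.le hθn hζ hτ hκ.le hΔ₁ hΔ₂ hΔΔ hZκ hZ'κ hZZκ hVb p q).trans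
      (mul_le_mul_of_nonneg_right ?_ (Real.exp_nonneg _))
    have hζn : 0 ≤ ζ * (n₁ : ℝ)⁻¹ := mul_nonneg hζ hn0
    -- Claim 1: 2θ₀ A V² ≤ K (|a|+1)²
    have hB1 : 2 * θ₀ * (|a| + c₀) * V ^ 2 ≤ ((c₀ + 1) ^ 2 * (2 * θ₀ + 1) * V ^ 2 + 1) * (|a| + 1) ^ 2 := by
      calc 2 * θ₀ * (|a| + c₀) * V ^ 2 ≤ 2 * θ₀ * ((c₀ + 1) ^ 2 * (|a| + 1) ^ 2) * V ^ 2 :=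
            mul_le_mul_of_nonneg_right (mul_le_mul_of_nonneg_left hA1 (by positivity)) hV2
        _ = 2 * θ₀ * ((c₀ + 1) ^ 2 * V ^ 2) * (|a| + 1) ^ 2 := by ring
        _ ≤ ((c₀ + 1) ^ 2 * (2 * θ₀ + 1) * V ^ 2 + 1) * (|a| + 1) ^ 2 := mul_le_mul_of_nonneg_right hθV hS0
    -- Claim 2: A² V² ≤ K (|a|+1)²
    have hB2 : (|a| + c₀) ^ 2 * V ^ 2 ≤ ((c₀ + 1) ^ 2 * (2 * θ₀ + 1) * V ^ 2 + 1) * (|a| + 1) ^ 2 := by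
      calc (|a| + c₀) ^ 2 * V ^ 2 ≤ (c₀ + 1) ^ 2 * (|a| + 1) ^ 2 * V ^ 2 := mul_le_mul_of_nonneg_right hA2 hV2
        _ = (c₀ + 1) ^ 2 * V ^ 2 * (|a| + 1) ^ 2 := by ring
        _ ≤ ((c₀ + 1) ^ 2 * (2 * θ₀ + 1) * V ^ 2 + 1) * (|a| + 1) ^ 2 := mul_le_mul_of_nonneg_right hcV hS0
    calc (θ₀ * (n₁ : ℝ)⁻¹ * ζ * (|a| + c₀) + (|a| + c₀) * τ * (|a| + c₀) + (|a| + c₀) * ζ * (θ₀ * (n₁ : ℝ)⁻¹)) * V ^ 2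
        = 2 * θ₀ * (|a| + c₀) * V ^ 2 * (ζ * (n₁ : ℝ)⁻¹) + (|a| + c₀) ^ 2 * V ^ 2 * τ := by ring
      _ ≤ ((c₀ + 1) ^ 2 * (2 * θ₀ + 1) * V ^ 2 + 1) * (|a| + 1) ^ 2 * (ζ * (n₁ : ℝ)⁻¹)
          + ((c₀ + 1) ^ 2 * (2 * θ₀ + 1) * V ^ 2 + 1) * (|a| + 1) ^ 2 * τ :=
          add_le_add (mul_le_mul_of_nonneg_right hB1 hζn) (mul_le_mul_of_nonneg_right hB2 hτ)
      _ = ((c₀ + 1) ^ 2 * (2 * θ₀ + 1) * V ^ 2 + 1) * (|a| + 1) ^ 2 * (τ + ζ * (n₁ : ℝ)⁻¹) := by ring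

end DeltaPol

end Summit.QuantumFields.YangMills.BalabanUVNodes.N15.UnitLayerBg

end
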